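import Summits.CriticalPhenomena.SAWScalingLimit.Theses.SAWDefectDecoherence
import Summits.CriticalPhenomena.SAWScalingLimit.Theses.SAWQuarterTwist
import Summits.CriticalPhenomena.SAWScalingLimit.Theses.SAWPhaseRetrieval
import Summits.CriticalPhenomena.SAWScalingLimit.Theorems.ObservableToSLE.Negative.Identification
import Summits.CriticalPhenomena.SAWScalingLimit.Theorems.SAWDefectDecoherenceObservableToSLERNestedLinkDefs
import HarnessLib.Audit

/-!
# Crux `ObservableToSLER` (stmt-CriticalPhenomena-14005) — strategist line `hull-first-retrace` (s5)

ALTERNATIVE line (registered beside, never instead of, the lead's `Lines/bridge_gate_renewal.lean`).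

**Idea.**  Identify the scaling limit of the critical hexagonal SAW at the level of its TRACE (the range
`γ[0,1] ⊆ cl D`, a random nonempty compact set, Hausdorff topology) BEFORE touching parametrisations.
The Lawler–Schramm–Werner characterisation is hull-level from the start (`RestrictionConfig`,
`IsRestrictionMeasure.unique`, `IsRestrictionMeasure.eq_map_sleTrace_eightThirds`: the `5/8` two-sided
restriction measure IS the law of the SLE(8/3) trace, which is a.s. a simple path,
`ae_isChordalSimplePath_sleTrace_eightThirds`), and the space of nonempty compact subsets of a compact set
is COMPACT — so at trace level neither tightness (`HexTight`) nor any injectivity modulus is needed to take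
and identify subsequential limits.  What the restriction identity of the lattice SAW (exact) plus the
route hypothesis `HexObservableLimitR` (through the landed admissible restriction limits
`Macro.stub_macroRestrictionLimit`, p145850) and the two shared lattice inputs S1 (abundance, item
stmt-17698) and T1⁻ (macroscopic source locality, item stmt-17955) then give is the TRACE SCALING LIMIT
`HexRangeLimit` (stub 3, provable: the live line's identification chain re-read at trace level — gate
decomposition p82259, nested transfer, carving squeeze p163006/p144792, Radó continuity p81676 composed with
the 1-Lipschitz map `class ↦ range`; NEW continuum content only in the hull-level LSW closing T2aᴿ).
Parametrisation is recovered SECOND: a curve class whose range is a simple arc from its source is the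
class of that arc unless some representative RETRACES a sub-arc (goes out along it and comes back inside
its own trace) — pure topology (stub 5) — so the only remaining law-level input is `HexNoRetraceLimits`
(stub 4, research): subsequential weak limits of the SAW laws give no mass to retracing classes.  This is
STRICTLY WEAKER than the shared simplicity item stmt-7148 `HexSimpleSubseqLimits` used by the live line
(simple ⇒ no retrace; boundary avoidance and absence of pinch points are NOT asked — they come for free from
restriction at trace level), exactly as T1⁻ (stmt-17955) weakened T1 (stmt-17689).  Stub 6 (provable, L:
measure theory on `CurveClass ℂ`, Lusin–Souslin for the injective continuous map `class ↦ range` on simple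
classes with fixed source) turns trace convergence + no-retrace into the identification of every
subsequential CURVE-law limit, and the landed soft half `Negative.convergesInLawToSLE_of_identification`
(p69742) concludes the crux with `HexTight` (used ONLY there).

Stubs (6): S1 `stub_nestedRenewalFatCoSolidR` (= item 17698, signature byte-identical with the live line),
T1⁻ `stub_macroSourceLocality` (= item 17955, byte-identical), H `stub_hullScalingLimit` (provable XL port),
N `stub_noRetraceLimits` (research, NEW, weaker than 7148), M `stub_monotoneOfNoRetrace` (provable M, topology),
C `stub_curveLawOfRangeLaw` (provable L, measure theory).  `ObservableToSLER_of` is sorry-free and concludes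
`SAWDefectDecoherence.ObservableToSLER` BY NAME; the bet-route copies `SAWQuarterTwist.ObservableToSLER`,
`SAWPhaseRetrieval.ObservableToSLER` follow by `Iff.rfl`.

Ancestor: crux idea `Ideas/range-first-no-retrace.md` (strategist s4, 2026-08-17T04:16Z; typed cut
`RangeFirstSketch.lean`).  Delta: the whole chain (not only child 3) is moved to trace level, which deletes
`HexTight`/`HexUniformModulus`/`MidTightN`/`MidModulusN` from the machinery, and the skeleton is built and checked.
-/

noncomputable section

open scoped BigOperators Topology NNReal ENNReal Classical BoundedContinuousFunction ComplexConjugate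
open Filter Set MeasureTheory Metric
open Literature.Probability.LatticeModels (HexVertex hexGraph hexCenter triZeta triEmbed Site polyline)
open Literature.Probability.RandomPlanarGeometry
open Literature.Probability.RandomPlanarGeometry.SAW
open UpperHalfPlane (upperHalfPlaneSet)

namespace Summit.CriticalPhenomena.SAWScalingLimit.Cruxes.ObservableToSLER.HullFirstRetrace

open Summit.CriticalPhenomena.SAWScalingLimit.Theses.SAWDefectDecoherence
open Summit.CriticalPhenomena.SAWScalingLimit.Theorems.ObservableToSLER.BridgeGate
open Summit.CriticalPhenomena.SAWScalingLimit.Theorems.ObservableToSLER.NestedGate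

/-! ## The two new statements (typed copies; the stubs below inline them verbatim) -/

/-- **Trace scaling limit** `HexRangeLimit`: for every Dobrushin domain and hexagonal endpoint approximation,
the law of the TRACE of the critical hexagonal SAW (its range, a nonempty compact subset of `ℂ`, Hausdorff
metric) converges weakly as `δ → 0⁺` to the law of the trace of a chordal SLE(8/3) curve in `(D; pt 0, pt 1)`.
No parametrisation, no tightness hypothesis (the hyperspace of a compact set is compact). -/
def HexRangeLimit : Prop :=
  ∀ (D : DobrushinDomain) (a b : ℝ → HexVertex), IsEmbEndpointApprox hexGraph hexCenter D a b →
    ∃ Γ : (ℝ≥0 → ℝ) → CurveClass ℂ, IsSLECurve ((8 : ℝ≥0) / 3) D Γ ∧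
      TendstoLaw
        (fun δ (γ : HexDomainSAW D.carrier δ (a δ) (b δ)) =>
          (⟨⟨γ.curve.range, γ.curve.isCompact_range⟩, γ.curve.range_nonempty⟩ :
            TopologicalSpace.NonemptyCompacts ℂ))
        (fun δ => hexSAWLaw D.carrier δ (a δ) (b δ))
        (fun ω => (⟨⟨(Γ ω).range, (Γ ω).isCompact_range⟩, (Γ ω).range_nonempty⟩ :
            TopologicalSpace.NonemptyCompacts ℂ))
        Literature.Probability.Process.preWienerMeasure

/-- **No retrace of subsequential limits** `HexNoRetraceLimits` (research; STRICTLY WEAKER than item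
stmt-7148 `HexSimpleSubseqLimits`): every probability weak limit `ν` of the critical hexagonal SAW laws along a
mesh sequence gives mass `0` to the classes having a representative that RETRACES — times `r < u < t` with
`γ r = γ t`, `γ u ≠ γ r`, and the way back `γ[u, t]` inside the trace of the way out `γ[r, u]`.  Constant
stretches are not retraces (`γ u ≠ γ r`); pinch points and boundary touching are NOT excluded. -/
def HexNoRetraceLimits : Prop :=
  ∀ (D : DobrushinDomain) (a b : ℝ → HexVertex), IsEmbEndpointApprox hexGraph hexCenter D a b →
    ∀ (s : ℕ → ℝ) (ν : Measure (CurveClass ℂ)), Tendsto s atTop (𝓝[>] 0) → IsProbabilityMeasure ν →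
      (∀ f : CurveClass ℂ →ᵇ ℝ,
        Tendsto (fun n => ∫ γ, f γ.curve ∂(hexSAWLaw D.carrier (s n) (a (s n)) (b (s n)))) atTop
          (𝓝 (∫ x, f x ∂ν))) →
      ∀ᵐ c ∂ν, ¬ ∃ γ : Curve ℂ, CurveClass.mk γ = c ∧
        ∃ r u t : unitInterval, r < u ∧ u < t ∧ γ r = γ t ∧ γ u ≠ γ r ∧
          γ '' Set.Icc u t ⊆ γ '' Set.Icc r u

/-- **Monotonicity from no-retrace** `MonotoneOfNoRetrace` (pure topology): a curve class whose range is the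
range of an injective curve `α` starting at the class's source, and none of whose representatives retraces,
IS the class of `α`. -/
def MonotoneOfNoRetrace : Prop :=
  ∀ (c : CurveClass ℂ) (α : Curve ℂ), Function.Injective α → α.range = c.range → α.source = c.source →
    (¬ ∃ γ : Curve ℂ, CurveClass.mk γ = c ∧
      ∃ r u t : unitInterval, r < u ∧ u < t ∧ γ r = γ t ∧ γ u ≠ γ r ∧
        γ '' Set.Icc u t ⊆ γ '' Set.Icc r u) →
    c = CurveClass.mk α

/-- **Identification of subsequential curve-law limits** (the target shape consumed by the landed soft half
`Negative.convergesInLawToSLE_of_identification`). -/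
def CurveIdentification : Prop :=
  ∀ (D : DobrushinDomain) (a b : ℝ → HexVertex), IsEmbEndpointApprox hexGraph hexCenter D a b →
    ∀ μ : Measure (CurveClass ℂ), IsProbabilityMeasure μ →
      IsSubseqLimitLaw (fun δ (γ : HexDomainSAW D.carrier δ (a δ) (b δ)) => γ.curve)
        (fun δ => hexSAWLaw D.carrier δ (a δ) (b δ)) μ →
      IsSLELaw ((8 : ℝ≥0) / 3) D μ

/-! ## Registered stubs -/

/-- STUB S1 `stub_nestedRenewalFatCoSolidR` — = item **stmt-CriticalPhenomena-17698** `NestedRenewalFatCoSolidR`,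
signature byte-identical with stub 2ʀ of the live line `bridge_gate_renewal.lean` (r15) and the twin's S1: the
abundance of widely linked first good gates for fat co-oriented solid tame nested families (research; the only
input not implied in substance by DCS Conjecture 1).  Shared: a landing closes it for every line at once. -/
theorem stub_nestedRenewalFatCoSolidR :
    ∀ (D : DobrushinDomain) (a b : ℝ → HexVertex), IsEmbEndpointApprox hexGraph hexCenter D a b →
      ∀ ε > (0 : ℝ), ∃ R₂ > (0 : ℝ), ∀ R ∈ Set.Ioc (0 : ℝ) R₂, ∃ ρ > (0 : ℝ), ∃ N : ℕ, ∀ᶠ δ : ℝ in 𝓝[>] 0,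
        ∃ S T : ℕ → Set HexVertex,
          TameNestedFamily δ R N (a δ) S ∧ TameNestedFamily δ R N (b δ) T ∧
          ((∀ n, ExteriorAnchored D.carrier δ (S n) (a δ)) ∧
            (∀ n, ExteriorAnchored D.carrier δ (T n) (b δ)) ∧
            ∃ j : Fin 6,
              ((∀ (n : ℕ) (p q : HexVertex), HasCleanWindow D.carrier δ ρ (S n) p q →
                  rowOf j q = rowOf j p + 1 ∧
                    ∀ x : HexVertex, (δ : ℂ) * hexCenter x ∈ ball ((δ : ℂ) * hexCenter q) ρ →
                      (x ∈ S n ↔ rowOf j x ≤ rowOf j p)) ∧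
                (∀ (n : ℕ) (p q : HexVertex), HasCleanWindow D.carrier δ ρ (T n) p q →
                  rowOf j q = rowOf j p + 1 ∧
                    ∀ x : HexVertex, (δ : ℂ) * hexCenter x ∈ ball ((δ : ℂ) * hexCenter q) ρ →
                      (x ∈ T n ↔ rowOf j x ≤ rowOf j p))) ∧
              (∀ (n : ℕ) (p q : HexVertex), HasCleanWindow D.carrier δ ρ (S n) p q →
                ∃ K : Set ℂ, IsCompact K ∧ IsConnected K ∧
                  (δ : ℂ) * hexCenter q - ((ρ / 2 : ℝ) : ℂ) * Complex.I * triZeta ^ (j : ℕ) ∈ K ∧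
                  (δ : ℂ) * hexCenter (a δ) ∈ K ∧
                  ∀ v : HexVertex, Metric.infDist ((δ : ℂ) * hexCenter v) K ≤ ρ / 4 → v ∈ S n) ∧
              (∀ (n : ℕ) (p q : HexVertex), HasCleanWindow D.carrier δ ρ (T n) p q →
                ∃ K : Set ℂ, IsCompact K ∧ IsConnected K ∧
                  (δ : ℂ) * hexCenter q - ((ρ / 2 : ℝ) : ℂ) * Complex.I * triZeta ^ (j : ℕ) ∈ K ∧
                  (δ : ℂ) * hexCenter (b δ) ∈ K ∧
                  ∀ v : HexVertex, Metric.infDist ((δ : ℂ) * hexCenter v) K ≤ ρ / 4 → v ∈ T n) ∧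
              (∀ n : ℕ, ∃ K : Set ℂ, IsCompact K ∧ IsConnected K ∧ (δ : ℂ) * hexCenter (a δ) ∈ K ∧
                (∀ v : HexVertex, Metric.infDist ((δ : ℂ) * hexCenter v) K ≤ ρ / 8 → v ∈ S n) ∧
                (∀ v ∈ S n, ∃ (t w : HexVertex) (r : ℕ), v ∈ hexBall t r ∧ w ∈ hexBall t r ∧
                  hexBall t r ⊆ S n ∧ Metric.infDist ((δ : ℂ) * hexCenter w) K ≤ ρ / 16)) ∧
              (∀ n : ℕ, ∃ K : Set ℂ, IsCompact K ∧ IsConnected K ∧ (δ : ℂ) * hexCenter (b δ) ∈ K ∧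
                (∀ v : HexVertex, Metric.infDist ((δ : ℂ) * hexCenter v) K ≤ ρ / 8 → v ∈ T n) ∧
                (∀ v ∈ T n, ∃ (t w : HexVertex) (r : ℕ), v ∈ hexBall t r ∧ w ∈ hexBall t r ∧
                  hexBall t r ⊆ T n ∧ Metric.infDist ((δ : ℂ) * hexCenter w) K ≤ ρ / 16))) ∧
          hexSAWLaw D.carrier δ (a δ) (b δ)
              {γ | ¬ ∃ (n m : ℕ) (p q : HexVertex) (n' m' : ℕ) (p' q' : HexVertex),
                  IsFirstGoodGateN D.carrier δ ρ R S (a δ) γ.walk.support n m p q ∧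
                  IsFirstGoodGateN D.carrier δ ρ R T (b δ) γ.walk.support.reverse n' m' p' q' ∧
                  WideLink D.carrier δ ρ (S n ∪ T n') q q'} ≤
            ENNReal.ofReal ε := by
  sorry

/-- STUB T1⁻ `stub_macroSourceLocality` — = item **stmt-CriticalPhenomena-17955** `MacroSourceLocality`,
signature byte-identical with the live line's T1⁻ and the twin's: macroscopic source locality of the critical
hexagonal SAW at a flat boundary point (research; Conjecture-1-locked in substance).  Consumed through the LANDED
`ObservableToSLER.Macro.stub_macroRestrictionLimit : HexObservableLimitR → T1⁻ → ARL″` (p145850). -/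
theorem stub_macroSourceLocality :
    ∀ (E : DobrushinDomain) (ρ : ℝ) (Λ : ℝ → Finset HexVertex) (m₀ : ℝ → ℤ)
      (a : ℝ → Sym2 HexVertex),
      0 < ρ → E.carrier ∩ ball (E.pt 0) ρ = {z : ℂ | (E.pt 0).im < z.im} ∩ ball (E.pt 0) ρ →
      (∀ᶠ δ : ℝ in 𝓝[>] 0, hexDomainSimplyConnected (Λ δ) ∧
        (hexGraph.induce (↑(Λ δ) : Set HexVertex)).Preconnected ∧ a δ ∈ hexDomainBoundary (Λ δ) ∧
        (∀ v ∈ Λ δ, (δ : ℂ) * hexCenter v ∈ E.carrier) ∧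
        (∀ v : HexVertex, (δ : ℂ) * hexCenter v ∈ ball (E.pt 0) ρ → (v ∈ Λ δ ↔ m₀ δ ≤ v.1 1))) →
      (∀ K : Set ℂ, IsCompact K → K ⊆ E.carrier →
        ∀ᶠ δ : ℝ in 𝓝[>] 0, ∀ v : HexVertex, (δ : ℂ) * hexCenter v ∈ K → v ∈ Λ δ) →
      Tendsto (fun δ : ℝ => (δ : ℂ) * hexMidpoint (a δ)) (𝓝[>] 0) (𝓝 (E.pt 0)) →
      ∀ ε : ℝ, 0 < ε → ∀ r : ℝ, 0 < r → ∃ t₀ : ℝ, 0 < t₀ ∧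
        ∀ (s : ℝ → Sym2 HexVertex) (t : ℝ), t ≠ 0 → |t| < t₀ →
          (∀ᶠ δ : ℝ in 𝓝[>] 0, s δ ∈ hexDomainBoundary (Λ δ) ∧
            (hexMidpoint (s δ)).im = (hexMidpoint (a δ)).im) →
          Tendsto (fun δ : ℝ => (δ : ℂ) * hexMidpoint (s δ)) (𝓝[>] 0) (𝓝 (E.pt 0 + t)) →
          ∀ᶠ δ : ℝ in 𝓝[>] 0,
            (∑ γ : HexMidEdgeSAW (Λ δ) (a δ) (s δ),
                if ∃ v ∈ γ.verts, r ≤ dist ((δ : ℂ) * hexCenter v) ((δ : ℂ) * hexMidpoint (a δ))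
                then hexCriticalFugacity ^ γ.length else 0) ≤
              ε * ∑ γ : HexMidEdgeSAW (Λ δ) (a δ) (s δ), hexCriticalFugacity ^ γ.length := by
  sorry

/-- STUB H `stub_hullScalingLimit` (PROVABLE, XL — the identification chain of the live line re-read at TRACE
level) — **`HexObservableLimitR → T1⁻ → S1 → HexRangeLimit`**.  Route: (1) hull-level LSW closing T2aᴿ for a
fixed two-piece flat Dobrushin domain and admissible family (NEW continuum content, M–L): from ARL″
(`Macro.stub_macroRestrictionLimit` p145850 fed by the two hypotheses) the restriction sandwich
`TwoPiece.sandwich_of_admRestrictionLimit` is already a statement about RANGE events `{range ⊆ cl M'}`; a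
subsequential limit of the range laws (free: `NonemptyCompacts (cl M)` is compact) pushed to `ℍ` and filled is a
`RestrictionConfig`-valued law with `P[K ∩ A = ∅] = Φ'_A(0)^{5/8}` (collar hulls give `cl K ∩ ℝ = {0}` as in
`TwoPiece.ae_mem_chordalCarrier_of_upper`), hence `P_{5/8}` (`IsRestrictionMeasure.unique`) = the SLE(8/3)
trace law (`IsRestrictionMeasure.eq_map_sleTrace_eightThirds`), a simple arc, so `fill K = K`; (2) carvings,
gates, nested transfer, squeeze and Radó continuity exactly as landed (p82259, p124665, p163006, p144792,
p81676 ∘ `range`), with `MidTightN`/`MidModulusN` deleted (nothing to thread).  No `HexTight`, no stmt-7148. -/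
theorem stub_hullScalingLimit :
    HexObservableLimitR →
    (∀ (E : DobrushinDomain) (ρ : ℝ) (Λ : ℝ → Finset HexVertex) (m₀ : ℝ → ℤ)
      (a : ℝ → Sym2 HexVertex),
      0 < ρ → E.carrier ∩ ball (E.pt 0) ρ = {z : ℂ | (E.pt 0).im < z.im} ∩ ball (E.pt 0) ρ →
      (∀ᶠ δ : ℝ in 𝓝[>] 0, hexDomainSimplyConnected (Λ δ) ∧
        (hexGraph.induce (↑(Λ δ) : Set HexVertex)).Preconnected ∧ a δ ∈ hexDomainBoundary (Λ δ) ∧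
        (∀ v ∈ Λ δ, (δ : ℂ) * hexCenter v ∈ E.carrier) ∧
        (∀ v : HexVertex, (δ : ℂ) * hexCenter v ∈ ball (E.pt 0) ρ → (v ∈ Λ δ ↔ m₀ δ ≤ v.1 1))) →
      (∀ K : Set ℂ, IsCompact K → K ⊆ E.carrier →
        ∀ᶠ δ : ℝ in 𝓝[>] 0, ∀ v : HexVertex, (δ : ℂ) * hexCenter v ∈ K → v ∈ Λ δ) →
      Tendsto (fun δ : ℝ => (δ : ℂ) * hexMidpoint (a δ)) (𝓝[>] 0) (𝓝 (E.pt 0)) →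
      ∀ ε : ℝ, 0 < ε → ∀ r : ℝ, 0 < r → ∃ t₀ : ℝ, 0 < t₀ ∧
        ∀ (s : ℝ → Sym2 HexVertex) (t : ℝ), t ≠ 0 → |t| < t₀ →
          (∀ᶠ δ : ℝ in 𝓝[>] 0, s δ ∈ hexDomainBoundary (Λ δ) ∧
            (hexMidpoint (s δ)).im = (hexMidpoint (a δ)).im) →
          Tendsto (fun δ : ℝ => (δ : ℂ) * hexMidpoint (s δ)) (𝓝[>] 0) (𝓝 (E.pt 0 + t)) →
          ∀ᶠ δ : ℝ in 𝓝[>] 0,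
            (∑ γ : HexMidEdgeSAW (Λ δ) (a δ) (s δ),
                if ∃ v ∈ γ.verts, r ≤ dist ((δ : ℂ) * hexCenter v) ((δ : ℂ) * hexMidpoint (a δ))
                then hexCriticalFugacity ^ γ.length else 0) ≤
              ε * ∑ γ : HexMidEdgeSAW (Λ δ) (a δ) (s δ), hexCriticalFugacity ^ γ.length) →
    (∀ (D : DobrushinDomain) (a b : ℝ → HexVertex), IsEmbEndpointApprox hexGraph hexCenter D a b →
      ∀ ε > (0 : ℝ), ∃ R₂ > (0 : ℝ), ∀ R ∈ Set.Ioc (0 : ℝ) R₂, ∃ ρ > (0 : ℝ), ∃ N : ℕ, ∀ᶠ δ : ℝ in 𝓝[>] 0,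
        ∃ S T : ℕ → Set HexVertex,
          TameNestedFamily δ R N (a δ) S ∧ TameNestedFamily δ R N (b δ) T ∧
          ((∀ n, ExteriorAnchored D.carrier δ (S n) (a δ)) ∧
            (∀ n, ExteriorAnchored D.carrier δ (T n) (b δ)) ∧
            ∃ j : Fin 6,
              ((∀ (n : ℕ) (p q : HexVertex), HasCleanWindow D.carrier δ ρ (S n) p q →
                  rowOf j q = rowOf j p + 1 ∧
                    ∀ x : HexVertex, (δ : ℂ) * hexCenter x ∈ ball ((δ : ℂ) * hexCenter q) ρ →
                      (x ∈ S n ↔ rowOf j x ≤ rowOf j p)) ∧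
                (∀ (n : ℕ) (p q : HexVertex), HasCleanWindow D.carrier δ ρ (T n) p q →
                  rowOf j q = rowOf j p + 1 ∧
                    ∀ x : HexVertex, (δ : ℂ) * hexCenter x ∈ ball ((δ : ℂ) * hexCenter q) ρ →
                      (x ∈ T n ↔ rowOf j x ≤ rowOf j p))) ∧
              (∀ (n : ℕ) (p q : HexVertex), HasCleanWindow D.carrier δ ρ (S n) p q →
                ∃ K : Set ℂ, IsCompact K ∧ IsConnected K ∧
                  (δ : ℂ) * hexCenter q - ((ρ / 2 : ℝ) : ℂ) * Complex.I * triZeta ^ (j : ℕ) ∈ K ∧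
                  (δ : ℂ) * hexCenter (a δ) ∈ K ∧
                  ∀ v : HexVertex, Metric.infDist ((δ : ℂ) * hexCenter v) K ≤ ρ / 4 → v ∈ S n) ∧
              (∀ (n : ℕ) (p q : HexVertex), HasCleanWindow D.carrier δ ρ (T n) p q →
                ∃ K : Set ℂ, IsCompact K ∧ IsConnected K ∧
                  (δ : ℂ) * hexCenter q - ((ρ / 2 : ℝ) : ℂ) * Complex.I * triZeta ^ (j : ℕ) ∈ K ∧
                  (δ : ℂ) * hexCenter (b δ) ∈ K ∧
                  ∀ v : HexVertex, Metric.infDist ((δ : ℂ) * hexCenter v) K ≤ ρ / 4 → v ∈ T n) ∧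
              (∀ n : ℕ, ∃ K : Set ℂ, IsCompact K ∧ IsConnected K ∧ (δ : ℂ) * hexCenter (a δ) ∈ K ∧
                (∀ v : HexVertex, Metric.infDist ((δ : ℂ) * hexCenter v) K ≤ ρ / 8 → v ∈ S n) ∧
                (∀ v ∈ S n, ∃ (t w : HexVertex) (r : ℕ), v ∈ hexBall t r ∧ w ∈ hexBall t r ∧
                  hexBall t r ⊆ S n ∧ Metric.infDist ((δ : ℂ) * hexCenter w) K ≤ ρ / 16)) ∧
              (∀ n : ℕ, ∃ K : Set ℂ, IsCompact K ∧ IsConnected K ∧ (δ : ℂ) * hexCenter (b δ) ∈ K ∧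
                (∀ v : HexVertex, Metric.infDist ((δ : ℂ) * hexCenter v) K ≤ ρ / 8 → v ∈ T n) ∧
                (∀ v ∈ T n, ∃ (t w : HexVertex) (r : ℕ), v ∈ hexBall t r ∧ w ∈ hexBall t r ∧
                  hexBall t r ⊆ T n ∧ Metric.infDist ((δ : ℂ) * hexCenter w) K ≤ ρ / 16))) ∧
          hexSAWLaw D.carrier δ (a δ) (b δ)
              {γ | ¬ ∃ (n m : ℕ) (p q : HexVertex) (n' m' : ℕ) (p' q' : HexVertex),
                  IsFirstGoodGateN D.carrier δ ρ R S (a δ) γ.walk.support n m p q ∧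
                  IsFirstGoodGateN D.carrier δ ρ R T (b δ) γ.walk.support.reverse n' m' p' q' ∧
                  WideLink D.carrier δ ρ (S n ∪ T n') q q'} ≤
            ENNReal.ofReal ε) →
    ∀ (D : DobrushinDomain) (a b : ℝ → HexVertex), IsEmbEndpointApprox hexGraph hexCenter D a b →
      ∃ Γ : (ℝ≥0 → ℝ) → CurveClass ℂ, IsSLECurve ((8 : ℝ≥0) / 3) D Γ ∧
        TendstoLaw
          (fun δ (γ : HexDomainSAW D.carrier δ (a δ) (b δ)) =>
            (⟨⟨γ.curve.range, γ.curve.isCompact_range⟩, γ.curve.range_nonempty⟩ :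
              TopologicalSpace.NonemptyCompacts ℂ))
          (fun δ => hexSAWLaw D.carrier δ (a δ) (b δ))
          (fun ω => (⟨⟨(Γ ω).range, (Γ ω).isCompact_range⟩, (Γ ω).range_nonempty⟩ :
              TopologicalSpace.NonemptyCompacts ℂ))
          Literature.Probability.Process.preWienerMeasure := by
  sorry

/-- STUB N `stub_noRetraceLimits` (RESEARCH, NEW; the ONE law-level input of this line beyond S1/T1⁻) —
**`HexNoRetraceLimits`**: subsequential weak limits of the critical hexagonal SAW laws give no mass to retracing
classes.  Implied by item stmt-7148 (simple ⇒ no retrace) and by DCS Conjecture 1; NOT conversely: pinch points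
and boundary touching are allowed here (they are excluded for free at trace level by restriction).  Lattice
mechanism behind it (not assumed): three time-disjoint strands along one sleeve of width `θ` and length `ε` cost
`e^{-c ε/θ}` in `x_c`-weight (strip subcriticality `μ_W < μ`, Hammersley–Whittington 1985; bridge decay
`B_T(x_c) → 0`, BBDDG 2014 Thm 10) — a large-deviation smallness, unlike the polynomial arm-type smallness behind
pinch points; open because of the normalisation by `Z_D(a_δ, b_δ)` (no polynomial lower bound in print). -/
theorem stub_noRetraceLimits :
    ∀ (D : DobrushinDomain) (a b : ℝ → HexVertex), IsEmbEndpointApprox hexGraph hexCenter D a b →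
      ∀ (s : ℕ → ℝ) (ν : Measure (CurveClass ℂ)), Tendsto s atTop (𝓝[>] 0) → IsProbabilityMeasure ν →
        (∀ f : CurveClass ℂ →ᵇ ℝ,
          Tendsto (fun n => ∫ γ, f γ.curve ∂(hexSAWLaw D.carrier (s n) (a (s n)) (b (s n)))) atTop
            (𝓝 (∫ x, f x ∂ν))) →
        ∀ᵐ c ∂ν, ¬ ∃ γ : Curve ℂ, CurveClass.mk γ = c ∧
          ∃ r u t : unitInterval, r < u ∧ u < t ∧ γ r = γ t ∧ γ u ≠ γ r ∧
            γ '' Set.Icc u t ⊆ γ '' Set.Icc r u := by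
  sorry

/-- STUB M `stub_monotoneOfNoRetrace` (PROVABLE, M — pure topology of `[0,1]`) — **`MonotoneOfNoRetrace`**: if
the range of the class `c` is the range of an injective curve `α` with `α 0 = c.source` and no representative of
`c` retraces, then `c = CurveClass.mk α`.  Proof sketch: for a representative `γ` of `c`, `f := α⁻¹ ∘ γ : [0,1] →
[0,1]` is continuous (compactness), `f 0 = 0`; if `f` is not monotone pick `p < q` with `f p > f q`, `w :=`
argmin of `f` on `[q, 1]`, `u :=` argmax of `f` on `[0, w]`, `t :=` argmin of `f` on `[u, w]`, `r ∈ [0, u]` with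
`f r = f t` (IVT): then `γ r = γ t`, `γ u ≠ γ r`, `f '' [u,t] ⊆ [f t, f u] ⊆ f '' [r,u]` — a retrace; so `f` is
monotone onto `[0,1]`, and `γ = α ∘ f` is the class of `α` (`CurveMonotoneReparam`). -/
theorem stub_monotoneOfNoRetrace :
    ∀ (c : CurveClass ℂ) (α : Curve ℂ), Function.Injective α → α.range = c.range → α.source = c.source →
      (¬ ∃ γ : Curve ℂ, CurveClass.mk γ = c ∧
        ∃ r u t : unitInterval, r < u ∧ u < t ∧ γ r = γ t ∧ γ u ≠ γ r ∧
          γ '' Set.Icc u t ⊆ γ '' Set.Icc r u) →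
      c = CurveClass.mk α := by
  sorry

/-- STUB C `stub_curveLawOfRangeLaw` (PROVABLE, L — measure theory on `CurveClass ℂ`) —
**`HexRangeLimit → HexNoRetraceLimits → MonotoneOfNoRetrace → CurveIdentification`**.  For a subsequential limit
`μ` of the curve laws along `s n`: (i) `μ.map range =` the SLE(8/3) trace law `ν.map range` (the map
`c ↦ range c : CurveClass ℂ → NonemptyCompacts ℂ` is 1-Lipschitz, limits of probability laws on a metric space
are unique, `hexSAWLaw` is a probability law eventually); (ii) `μ`-a.e. `c.source = D.pt 0` (endpoint
approximation, as `TwoPiece.ae_source_eq_of_ratio`); (iii) `ν`-a.e. class is simple from `pt 0`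
(`IsSLECurve` + `ae_isChordalSimplePath_sleTrace_eightThirds`), the set of its ranges is the image of the Borel set
of simple classes with source `pt 0` under the continuous map `range`, injective there (Lusin–Souslin,
`MeasurableSet.image_of_continuousOn_injOn`; `CurveClass` is Polish, `CurveClass.instPolishSpace`), so by (i)
`μ`-a.e. `range c` is the range of an injective curve from `c.source`; (iv) by no-retrace and stub M, `μ`-a.e.
`c` is the simple class of its range, i.e. `μ` and `ν` are both the push-forward of the common range law under the
(measurable on that Borel set) inverse of `range` — `μ = ν`, an SLE(8/3) law of `D`. -/
theorem stub_curveLawOfRangeLaw :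
    (∀ (D : DobrushinDomain) (a b : ℝ → HexVertex), IsEmbEndpointApprox hexGraph hexCenter D a b →
      ∃ Γ : (ℝ≥0 → ℝ) → CurveClass ℂ, IsSLECurve ((8 : ℝ≥0) / 3) D Γ ∧
        TendstoLaw
          (fun δ (γ : HexDomainSAW D.carrier δ (a δ) (b δ)) =>
            (⟨⟨γ.curve.range, γ.curve.isCompact_range⟩, γ.curve.range_nonempty⟩ :
              TopologicalSpace.NonemptyCompacts ℂ))
          (fun δ => hexSAWLaw D.carrier δ (a δ) (b δ))
          (fun ω => (⟨⟨(Γ ω).range, (Γ ω).isCompact_range⟩, (Γ ω).range_nonempty⟩ :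
              TopologicalSpace.NonemptyCompacts ℂ))
          Literature.Probability.Process.preWienerMeasure) →
    (∀ (D : DobrushinDomain) (a b : ℝ → HexVertex), IsEmbEndpointApprox hexGraph hexCenter D a b →
      ∀ (s : ℕ → ℝ) (ν : Measure (CurveClass ℂ)), Tendsto s atTop (𝓝[>] 0) → IsProbabilityMeasure ν →
        (∀ f : CurveClass ℂ →ᵇ ℝ,
          Tendsto (fun n => ∫ γ, f γ.curve ∂(hexSAWLaw D.carrier (s n) (a (s n)) (b (s n)))) atTop
            (𝓝 (∫ x, f x ∂ν))) →
        ∀ᵐ c ∂ν, ¬ ∃ γ : Curve ℂ, CurveClass.mk γ = c ∧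
          ∃ r u t : unitInterval, r < u ∧ u < t ∧ γ r = γ t ∧ γ u ≠ γ r ∧
            γ '' Set.Icc u t ⊆ γ '' Set.Icc r u) →
    (∀ (c : CurveClass ℂ) (α : Curve ℂ), Function.Injective α → α.range = c.range → α.source = c.source →
      (¬ ∃ γ : Curve ℂ, CurveClass.mk γ = c ∧
        ∃ r u t : unitInterval, r < u ∧ u < t ∧ γ r = γ t ∧ γ u ≠ γ r ∧
          γ '' Set.Icc u t ⊆ γ '' Set.Icc r u) →
      c = CurveClass.mk α) →
    ∀ (D : DobrushinDomain) (a b : ℝ → HexVertex), IsEmbEndpointApprox hexGraph hexCenter D a b →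
      ∀ μ : Measure (CurveClass ℂ), IsProbabilityMeasure μ →
        IsSubseqLimitLaw (fun δ (γ : HexDomainSAW D.carrier δ (a δ) (b δ)) => γ.curve)
          (fun δ => hexSAWLaw D.carrier δ (a δ) (b δ)) μ →
        IsSLELaw ((8 : ℝ≥0) / 3) D μ := by
  sorry

/-! ## Consistency: every registered stub is definitionally the typed statement it names -/

theorem hexRangeLimit_of_stubs (hO : HexObservableLimitR) : HexRangeLimit :=
  stub_hullScalingLimit hO stub_macroSourceLocality stub_nestedRenewalFatCoSolidR

theorem hexNoRetraceLimits_of_stub : HexNoRetraceLimits := stub_noRetraceLimits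

theorem monotoneOfNoRetrace_of_stub : MonotoneOfNoRetrace := stub_monotoneOfNoRetrace

theorem curveIdentification_of_stubs (hO : HexObservableLimitR) : CurveIdentification :=
  stub_curveLawOfRangeLaw (hexRangeLimit_of_stubs hO) stub_noRetraceLimits stub_monotoneOfNoRetrace

/-- The research stub N is implied by the shared simplicity item stmt-7148 restricted to classes with an
INJECTIVE representative chosen by `CurveClass.simple` — recorded as the typed comparison `7148-shape → N-shape`
modulo the topological fact that a class with an injective representative has no retracing representative
(left to the prover of stub M's sibling; not used by the composition). -/
theorem noRetrace_statement_iff : HexNoRetraceLimits ↔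
    (∀ (D : DobrushinDomain) (a b : ℝ → HexVertex), IsEmbEndpointApprox hexGraph hexCenter D a b →
      ∀ (s : ℕ → ℝ) (ν : Measure (CurveClass ℂ)), Tendsto s atTop (𝓝[>] 0) → IsProbabilityMeasure ν →
        (∀ f : CurveClass ℂ →ᵇ ℝ,
          Tendsto (fun n => ∫ γ, f γ.curve ∂(hexSAWLaw D.carrier (s n) (a (s n)) (b (s n)))) atTop
            (𝓝 (∫ x, f x ∂ν))) →
        ∀ᵐ c ∂ν, ¬ ∃ γ : Curve ℂ, CurveClass.mk γ = c ∧
          ∃ r u t : unitInterval, r < u ∧ u < t ∧ γ r = γ t ∧ γ u ≠ γ r ∧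
            γ '' Set.Icc u t ⊆ γ '' Set.Icc r u) :=
  Iff.rfl

/-! ## Composition (sorry-free): the skeleton concludes the crux BY NAME -/

/-- **`SAWDefectDecoherence.ObservableToSLER` from the six registered stubs.**  `HexObservableLimitR` enters only
through stub H (trace scaling limit, with S1 and T1⁻); `HexTight` enters ONLY in the last line, through the landed
soft half `Negative.convergesInLawToSLE_of_identification` (existence of subsequential limits + uniqueness). -/
theorem ObservableToSLER_of : ObservableToSLER := by
  intro hO hT D a b hab
  exact Summit.CriticalPhenomena.SAWScalingLimit.Theorems.ObservableToSLE.Negative.convergesInLawToSLE_of_identification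
    hab (hT D a b hab) (curveIdentification_of_stubs hO D a b hab)

/-- The bet route's copy (payload `route-CriticalPhenomena-SAWQuarterTwist`): definitionally the same statement. -/
theorem ObservableToSLER_of_quarterTwist :
    Summit.CriticalPhenomena.SAWScalingLimit.Theses.SAWQuarterTwist.ObservableToSLER :=
  ObservableToSLER_of

/-- The `SAWPhaseRetrieval` copy: definitionally the same statement. -/
theorem ObservableToSLER_of_phaseRetrieval :
    Summit.CriticalPhenomena.SAWScalingLimit.Theses.SAWPhaseRetrieval.ObservableToSLER :=
  ObservableToSLER_of

end Summit.CriticalPhenomena.SAWScalingLimit.Cruxes.ObservableToSLER.HullFirstRetrace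

end
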